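import Literature.Geometry.Symplectic.KahlerDecomposition
import Literature.Geometry.Symplectic.SteinBallContact
import Literature.Topology.FourManifolds.ClosedBallProofs
import Mathlib.Geometry.Manifold.Instances.Sphere
import HarnessLib

/-!
# The Kähler decomposition of the 4-sphere: `S⁴ = B⁴ ∪_{S³} B̄⁴` (the model case of Baykur's
# theorem, proved)

Sibling (proofs) file of `KahlerDecomposition.lean`, whose one named fact
`Literature.Geometry.Symplectic.baykur_kahlerDecomposition` (Baykur 2006, Thm. 5.1: every closed
oriented smooth 4-manifold is a gluing `W₁ ∪_ψ W₂` of two compact Stein domains whose fields of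
maximal complex tangencies agree pointwise on the common boundary) is XL and stays a named fact.
Here its conclusion is **proved for `X = S⁴`** — the *standard* decomposition of the 4-sphere
into two Stein balls, Baykur's own first example (§6, Example 2: *"The easiest examples are
doubles. If `Y⁴` is a compact Kähler manifold with strictly pseudoconvex boundary, then
`X = Y ∪ −Y` is equipped with a folded Kähler structure. When `Y` is indeed Stein, we get a
nicely folded structure. The first folded structure constructed in §3 is the double of standard
`D⁴ ⊂ ℂ²`"*; §3: the standard folded form on `S²ⁿ ⊂ ℝ²ⁿ⁺¹` *"is equivalent to doubling the
unit disk equipped with its standard symplectic form"*; §4, Example 1: undoing the surgery in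
the construction *"what we get is the standard folded symplectic form `ω₀` on `S⁴`"*) and the
zero-handle case of every induction in the proof of Thm. 5.1:

* the two pieces are two copies of the closed unit ball `B⁴ ⊂ ℂ²` with its standard Stein
  structure `(J₀, ‖z‖²)` (`Literature.Geometry.Symplectic.steinStructureClosedBall`,
  `SteinBall.lean`);
* the gluing is the double `S⁴ = B⁴ ∪_{id} B⁴`
  (`Literature.Topology.FourManifolds.isDouble_sphere_holds`, `ClosedBallProofs.lean`), along the
  identity diffeomorphism of the boundary datum `∂B⁴ = S³`
  (`Literature.Topology.FourManifolds.closedBallBoundaryData 3`);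
* **the contact-matching clause holds**: the differential of the boundary inclusion
  `ι : S³ ↪ B⁴` carries the pulled-back complex tangencies `boundaryPlaneField J₀ ∂B⁴`
  (`PlanarContactBoundary.lean`) ONTO the complex tangencies `contactPlane J₀` of `∂B⁴`
  (`SteinBoundaryContact.lean`) — because the latter lie in the range of `dι`
  (`contactPlane_le_range_mfderiv_incl`: a complex tangency is tangent to `S³`, read ambiently
  through `Dι = closedBallCoeDeriv`, `mem_contactPlane_steinStructureClosedBall_iff`, and
  `T S³ = range d(S³ ↪ ℝ⁴)`, Mathlib's `range_mfderiv_coe_sphere`).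

So the statement of the fact is satisfiable as rendered (its conclusion is not vacuous), and the
conclusion transports to every smooth 4-manifold diffeomorphic to `S⁴`
(`baykur_kahlerDecomposition_of_diffeomorph_sphere`) — the Stein bisection of the standard
4-sphere along its standard tight contact equator asked for, for *homotopy* 4-spheres, by the
consumers of the fact (route `SmoothPoincare4/ConvexBisection`).

## Contents (everything proved)

* `contactPlane_le_range_mfderiv_incl` — `ξ_{ι z} ≤ range dι_z` on `∂B⁴`;
* `map_mfderiv_incl_boundaryPlaneField` — `dι_z (ι^* ξ)_z = ξ_{ι z}`;
* `baykur_kahlerDecomposition_sphere` — the conclusion of `baykur_kahlerDecomposition` for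
  `X = S⁴`;
* `baykur_kahlerDecomposition_of_diffeomorph_sphere` — the same for any `X ≅ S⁴`.

## References

* R. İ. Baykur, *Kähler decomposition of 4-manifolds*, Algebr. Geom. Topol. 6 (2006) 1239–1265
  (arXiv:math/0601396), Thm. 5.1; §6 Example 2 and §3 (the double of the standard `D⁴ ⊂ ℂ²` is
  the standard folded Kähler `S⁴`); §4 Example 1. [Baykur2006]
* R. E. Gompf, *Handlebody construction of Stein surfaces*, Ann. of Math. 148 (1998), §1 (the
  standard Stein ball and the standard contact `S³`). [Gompf1998]
-/

noncomputable section

open scoped Manifold ContDiff RealInnerProductSpace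
open Set Function Metric

namespace Literature.Geometry.Symplectic

open Literature.Topology.FourManifolds

/-! ### The complex tangencies of `∂B⁴` lie in the range of the differential of `S³ ↪ B⁴` -/

/-- **`ξ_{ι z} ≤ range dι_z`**: every complex tangency of `∂B⁴` at `ι z` (`z ∈ S³`,
`ι = (closedBallBoundaryData 3).incl` the boundary inclusion) is the image under `dι_z` of a
tangent vector of `S³`.  Read ambiently through `Dι = closedBallCoeDeriv`, a complex tangency
`u` satisfies `Dι u ⊥ z` (`mem_contactPlane_steinStructureClosedBall_iff`), i.e.
`Dι u ∈ T_zS³ = (ℝ z)ᗮ = range d(S³ ↪ ℝ⁴)_z` (`range_mfderiv_coe_sphere`), and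
`Dι ∘ dι = d(S³ ↪ ℝ⁴)` (chain rule, `mfderiv_coe_closedBall`) with `Dι` injective. [folklore] -/
theorem contactPlane_le_range_mfderiv_incl
    (z : Metric.sphere (0 : EuclideanSpace ℝ (Fin 4)) 1) :
    contactPlane steinStructureClosedBall.J ((closedBallBoundaryData 3).incl z) ≤
      LinearMap.range
        (mfderiv (𝓡 3) (𝓡∂ 4) (closedBallBoundaryData 3).incl z).toLinearMap := by
  haveI := Literature.Topology.FourManifolds.fact_finrank_euclideanSpace_succ 3
  intro u hu
  have hx : ‖(((closedBallBoundaryData 3).incl z :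
      Metric.closedBall (0 : EuclideanSpace ℝ (Fin 4)) 1) : EuclideanSpace ℝ (Fin 4))‖ = 1 :=
    norm_eq_of_mem_sphere z
  obtain ⟨h1, -⟩ := (mem_contactPlane_steinStructureClosedBall_iff hx u).1 hu
  -- `Dι u ⊥ z`, so `Dι u` is tangent to `S³` at `z`: it is `d(S³ ↪ ℝ⁴)_z w` for some `w`
  have hmem : closedBallCoeDeriv ((closedBallBoundaryData 3).incl z) u ∈
      (ℝ ∙ (z : EuclideanSpace ℝ (Fin 4)))ᗮ := by
    rw [Submodule.mem_orthogonal_singleton_iff_inner_right]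
    exact h1
  obtain ⟨w, hw⟩ := LinearMap.mem_range.1 ((range_mfderiv_coe_sphere (n := 3) z).ge hmem)
  refine ⟨w, ?_⟩
  have hf : MDifferentiableAt (𝓡 3) (𝓡∂ 4) (closedBallBoundaryData 3).incl z :=
    ((closedBallBoundaryData 3).isSmoothEmbedding.contMDiff z).mdifferentiableAt (by simp)
  have hval : MDifferentiableAt (𝓡∂ 4) 𝓘(ℝ, EuclideanSpace ℝ (Fin 4))
      (Subtype.val : Metric.closedBall (0 : EuclideanSpace ℝ (Fin 4)) 1 → EuclideanSpace ℝ (Fin 4))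
      ((closedBallBoundaryData 3).incl z) :=
    (contMDiff_coe_closedBall (n := 3) _).mdifferentiableAt (by simp)
  -- chain rule through the inclusion `B⁴ ↪ ℝ⁴`: `Dι (dι w) = d(S³ ↪ ℝ⁴) w`
  have key : closedBallCoeDeriv ((closedBallBoundaryData 3).incl z)
      (mfderiv (𝓡 3) (𝓡∂ 4) (closedBallBoundaryData 3).incl z w) =
      mfderiv (𝓡 3) 𝓘(ℝ, EuclideanSpace ℝ (Fin 4))
        (Subtype.val : Metric.sphere (0 : EuclideanSpace ℝ (Fin 4)) 1 → EuclideanSpace ℝ (Fin 4))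
        z w := by
    have hc := mfderiv_comp z hval hf
    rw [mfderiv_coe_closedBall] at hc
    have h2 :=
      congrArg (fun L : EuclideanSpace ℝ (Fin 3) →L[ℝ] EuclideanSpace ℝ (Fin 4) => L w) hc
    exact h2.symm.trans rfl
  apply (closedBallCoeDeriv ((closedBallBoundaryData 3).incl z)).injective
  show closedBallCoeDeriv ((closedBallBoundaryData 3).incl z)
      (mfderiv (𝓡 3) (𝓡∂ 4) (closedBallBoundaryData 3).incl z w) = _
  rw [key]
  exact hw

/-- **`dι_z (ι^* ξ)_z = ξ_{ι z}`**: the differential of the boundary inclusion `ι : S³ ↪ B⁴`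
carries the pulled-back plane field `boundaryPlaneField J₀ ∂B⁴` (the complex tangencies pulled
back to the abstract boundary `S³`) onto the complex tangencies `contactPlane J₀` — the
contact-matching clause of `baykur_kahlerDecomposition` for the identity gluing map. [folklore] -/
theorem map_mfderiv_incl_boundaryPlaneField
    (z : Metric.sphere (0 : EuclideanSpace ℝ (Fin 4)) 1) :
    Submodule.map (mfderiv (𝓡 3) (𝓡∂ 4) (closedBallBoundaryData 3).incl z).toLinearMap
        (boundaryPlaneField steinStructureClosedBall.J (closedBallBoundaryData 3) z) =
      contactPlane steinStructureClosedBall.J ((closedBallBoundaryData 3).incl z) :=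
  Submodule.map_comap_eq_self (contactPlane_le_range_mfderiv_incl z)

/-! ### The Kähler decomposition of `S⁴` -/

/-- **The Kähler decomposition of the 4-sphere (Baykur's theorem for `X = S⁴`, proved):** the
round sphere `S⁴` is the gluing `B⁴ ∪_{id} B⁴` of two copies of the closed unit ball of `ℂ²`
with its standard Stein structure (`steinStructureClosedBall`), along the identity of
`∂B⁴ = S³` (`isDouble_sphere_holds`), and under this identification the two fields of maximal
complex tangencies of the boundaries coincide pointwise (`map_mfderiv_incl_boundaryPlaneField`).
This is the conclusion of the named fact `baykur_kahlerDecomposition` for `X = S⁴` — the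
standard model `S⁴ = B⁴ ∪ B̄⁴` folded along the standard tight contact `S³` (print, §6
Example 2: *"The easiest examples are doubles … When `Y` is indeed Stein, we get a nicely folded
structure. The first folded structure constructed in §3 is the double of standard `D⁴ ⊂ ℂ²`"*).
[cite: Baykur2006, Thm. 5.1 with §6 Example 2 and §3] -/
theorem baykur_kahlerDecomposition_sphere :
    ∃ (W₁ : Type) (_ : TopologicalSpace W₁) (_ : ChartedSpace (EuclideanHalfSpace 4) W₁)
      (_ : IsManifold (𝓡∂ 4) ∞ W₁) (_ : CompactSpace W₁)
      (W₂ : Type) (_ : TopologicalSpace W₂) (_ : ChartedSpace (EuclideanHalfSpace 4) W₂)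
      (_ : IsManifold (𝓡∂ 4) ∞ W₂) (_ : CompactSpace W₂)
      (S₁ : SteinStructure W₁) (S₂ : SteinStructure W₂)
      (b₁ : BoundaryData (𝓡∂ 4) W₁ (𝓡 3)) (b₂ : BoundaryData (𝓡∂ 4) W₂ (𝓡 3))
      (ψ : b₁.carrier ≃ₘ⟮𝓡 3, 𝓡 3⟯ b₂.carrier),
      (∀ z, Submodule.map (mfderiv (𝓡 3) (𝓡∂ 4) (b₂.incl ∘ ψ) z).toLinearMap
          (boundaryPlaneField S₁.J b₁ z) = contactPlane S₂.J (b₂.incl (ψ z))) ∧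
        IsBoundaryGluing b₁ b₂ ψ (𝓡 4) (Metric.sphere (0 : EuclideanSpace ℝ (Fin (4 + 1))) 1) := by
  refine ⟨Metric.closedBall (0 : EuclideanSpace ℝ (Fin 4)) 1, _, _, _, _,
    Metric.closedBall (0 : EuclideanSpace ℝ (Fin 4)) 1, _, _, _, _,
    steinStructureClosedBall, steinStructureClosedBall,
    closedBallBoundaryData 3, closedBallBoundaryData 3, Diffeomorph.refl (𝓡 3) _ ∞, ?_, ?_⟩
  · intro z
    rw [Diffeomorph.coe_refl, Function.comp_id]
    exact map_mfderiv_incl_boundaryPlaneField z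
  · rw [Diffeomorph.coe_refl]
    exact isDouble_sphere_holds (n := 3)

/-- **Baykur's theorem for every smooth 4-manifold diffeomorphic to `S⁴` (proved):** the
conclusion of `baykur_kahlerDecomposition` transports along a diffeomorphism `S⁴ ≅ X`
(post-compose the two piece embeddings; the Stein pieces, boundary data, gluing map and the
contact matching are untouched). [cite: Baykur2006, Thm. 5.1 with §6 Example 2 and §3] -/
theorem baykur_kahlerDecomposition_of_diffeomorph_sphere (X : Type*) [TopologicalSpace X]
    [ChartedSpace (EuclideanSpace ℝ (Fin 4)) X] [IsManifold (𝓡 4) ∞ X]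
    (e : Metric.sphere (0 : EuclideanSpace ℝ (Fin (4 + 1))) 1 ≃ₘ⟮𝓡 4, 𝓡 4⟯ X) :
    ∃ (W₁ : Type) (_ : TopologicalSpace W₁) (_ : ChartedSpace (EuclideanHalfSpace 4) W₁)
      (_ : IsManifold (𝓡∂ 4) ∞ W₁) (_ : CompactSpace W₁)
      (W₂ : Type) (_ : TopologicalSpace W₂) (_ : ChartedSpace (EuclideanHalfSpace 4) W₂)
      (_ : IsManifold (𝓡∂ 4) ∞ W₂) (_ : CompactSpace W₂)
      (S₁ : SteinStructure W₁) (S₂ : SteinStructure W₂)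
      (b₁ : BoundaryData (𝓡∂ 4) W₁ (𝓡 3)) (b₂ : BoundaryData (𝓡∂ 4) W₂ (𝓡 3))
      (ψ : b₁.carrier ≃ₘ⟮𝓡 3, 𝓡 3⟯ b₂.carrier),
      (∀ z, Submodule.map (mfderiv (𝓡 3) (𝓡∂ 4) (b₂.incl ∘ ψ) z).toLinearMap
          (boundaryPlaneField S₁.J b₁ z) = contactPlane S₂.J (b₂.incl (ψ z))) ∧
        IsBoundaryGluing b₁ b₂ ψ (𝓡 4) X := by
  obtain ⟨W₁, t₁, c₁, m₁, k₁, W₂, t₂, c₂, m₂, k₂, S₁, S₂, b₁, b₂, ψ, hξ, hglue⟩ :=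
    baykur_kahlerDecomposition_sphere
  refine ⟨W₁, t₁, c₁, m₁, k₁, W₂, t₂, c₂, m₂, k₂, S₁, S₂, b₁, b₂, ψ, hξ, ?_⟩
  -- transport the closed gluing along `e`: post-compose both piece embeddings
  obtain ⟨jA, jB, hA, hB, hU, hR⟩ := hglue
  have hs : Surjective (⇑e) := e.surjective
  have hi : Injective (⇑e) := e.injective
  refine ⟨e ∘ jA, e ∘ jB, hA.diffeomorph_comp e, hB.diffeomorph_comp e, ?_, fun a b => ?_⟩
  · rw [range_comp, range_comp, ← image_union, hU, image_univ, hs.range_eq]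
  · rw [comp_apply, comp_apply, hi.eq_iff, hR a b]

end Literature.Geometry.Symplectic

end
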